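import Literature.Geometry.Symplectic.OrigamiMoserField
import Literature.Analysis.Calculus.HadamardDivisionLast
import HarnessLib

/-!
# The origami Moser argument, V: the Moser field is smooth near the zero section

Fifth file of the proof of the named fact `Literature.Geometry.Symplectic.exists_origamiCollarNormalForm`
(Cannas da Silva–Guillemin–Woodward 2000, Thm. 1).  The data of the Moser argument on the collar
`N × ℝ` are packaged as `MoserData`: a smooth closed `2`-form `Ω₀` (the collar form `c^*ω`), a
smooth `1`-form `μ` (the fibre primitive of `ω₁ - Ω₀`) flat to second order along the zero
section, and the null direction `X` of `Ω₀` along the zero section, with the first-order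
positivity of both ends `Ω₀`, `Ω₁ = Ω₀ + dμ` of the segment `Ωs s = Ω₀ + s dμ` on
`((0,1), (X,0))`.  For such data the global Moser field `moserField Ωs μ`
(`OrigamiMoserField.lean`) is, near every point `(s₀, (n₀, 0))` with `s₀ ∈ [0, 1]`:

* **smooth** (`MoserData.contMDiffAt_nhds_zero`) — read in the product chart at `(n₀, 0)`,
  `μ̂ = t μ̃` and `Pf(Ω̂_s) = t π̂` with `μ̃, π̂` smooth (`exists_local_lastQuot`), `π̂ ≠ 0`
  (`deriv_pfF_segment_ne_zero`) and `μ̃ = 0` on the zero section (flatness of `μ`), so that the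
  field is the cancelled Moser vector `moserVec Ω̂_s μ̃ π̂`, smooth;
* **non-degenerate off the zero section**: `Pf(Ω_s (n, t)) ≠ 0` for `t ≠ 0` near by, whence the
  Moser equation `Ω_s(X_s, ·) = -μ` there (`apply_moserField`).

Everything here is proved; no facts.

## References

* A. Cannas da Silva, V. Guillemin, C. Woodward, *On the unfolding of folded symplectic
  structures*, Math. Res. Lett. 7 (2000), proof of Thm. 1. [CannasGuilleminWoodward2000]
* D. McDuff, D. Salamon, *Introduction to Symplectic Topology*, 3rd ed. (2017), §3.2.
  [McDuffSalamon2017]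
-/

noncomputable section

open scoped Manifold ContDiff Topology Bundle
open Set Function Filter
open Literature.Geometry.Kaehler Literature.Analysis.Calculus

namespace Literature.Geometry.Symplectic

namespace OrigamiMoser

local notation "E3" => EuclideanSpace ℝ (Fin 3)
local notation "F4" => EuclideanSpace ℝ (Fin 3) × ℝ
local notation "I34" => ModelWithCorners.prod (𝓡 3) 𝓘(ℝ, ℝ)

/-! ### The data of the Moser argument on the collar -/

/-- **Data of the origami Moser argument** on the collar `N × ℝ`: the collar form `Ω₀`, the
primitive `μ` of `ω₁ - Ω₀` (flat to second order along the zero section), the null direction `X`,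
and the first-order positivity at both ends of the segment.
[cite: CannasGuilleminWoodward2000, proof of Thm. 1] -/
structure MoserData (N : Type*) [TopologicalSpace N] [ChartedSpace (EuclideanSpace ℝ (Fin 3)) N] where
  /-- The collar form `c^*ω`. -/
  Ω₀ : MForm I34 (N × ℝ) ℝ 2
  /-- The primitive of `ω₁ - c^*ω`. -/
  μ : MForm I34 (N × ℝ) ℝ 1
  /-- The null direction along the fold. -/
  X : N → EuclideanSpace ℝ (Fin 3)
  smooth_Ω₀ : IsSmoothForm Ω₀
  closed_Ω₀ : IsClosedForm Ω₀
  smooth_μ : IsSmoothForm μ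
  σ_zero : ∀ n, mextDeriv μ (n, 0) = 0
  μ_zero : ∀ n, μ (n, 0) = 0
  μ_flat : ∀ n, HasDerivAt (fibreCurve μ n) 0 0
  X_ne : ∀ n, X n ≠ 0
  ker_v : ∀ n w, Ω₀ (n, 0) ![vVec, w] = 0
  ker_X : ∀ n w, Ω₀ (n, 0) ![((X n, 0) : F4), w] = 0
  Ω₀_ne : ∀ n, Ω₀ (n, 0) ≠ 0
  pos₀ : ∀ n, 0 < deriv (fibreCurve Ω₀ n) 0 ![vVec, ((X n, 0) : F4)]
  pos₁ : ∀ n, 0 < deriv (fibreCurve (Ω₀ + mextDeriv μ) n) 0 ![vVec, ((X n, 0) : F4)]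

namespace MoserData

variable {N : Type*} [TopologicalSpace N] [ChartedSpace (EuclideanSpace ℝ (Fin 3)) N]
  (D : MoserData N)

/-- The derivative of the segment: `σ = dμ`. [folklore] -/
def σ : MForm I34 (N × ℝ) ℝ 2 := mextDeriv D.μ

/-- **The Moser segment** `Ω_s = Ω₀ + s dμ`. [cite: McDuffSalamon2017, §3.2] -/
def Ωs (s : ℝ) : MForm I34 (N × ℝ) ℝ 2 := D.Ω₀ + s • D.σ

/-- The value of `Ω_s`. [folklore] -/
theorem Ωs_apply (s : ℝ) (p : N × ℝ) : D.Ωs s p = D.Ω₀ p + s • D.σ p := rfl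

/-- The chart representative of `Ω_s`. [folklore] -/
theorem inChart_Ωs (s : ℝ) (x₀ : N × ℝ) (q : F4) :
    (D.Ωs s).inChart x₀ q = D.Ω₀.inChart x₀ q + s • D.σ.inChart x₀ q := rfl

/-- On the zero section `Ω_s = Ω₀`. [folklore] -/
theorem Ωs_zero_section (s : ℝ) (n : N) : D.Ωs s (n, 0) = D.Ω₀ (n, 0) := by
  rw [Ωs_apply, show D.σ (n, 0) = 0 from D.σ_zero n, smul_zero, add_zero]

/-- On the zero section `Ω_s` is degenerate: `pfF (Ω_s (n, 0)) = 0`. [folklore] -/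
theorem pfF_Ωs_zero_section (s : ℝ) (n : N) : pfF (D.Ωs s (n, 0)) = 0 := by
  rw [Ωs_zero_section, pfF_eq_zero_iff]
  refine ⟨vVec, ?_, D.ker_v n⟩
  intro h
  have := congrArg Prod.snd h
  simp [vVec] at this

/-- On the zero section `Ω_s` is degenerate (point form). [folklore] -/
theorem pfF_Ωs_zero_section' (s : ℝ) (z : N × ℝ) (hz : z.2 = 0) : pfF (D.Ωs s z) = 0 := by
  obtain ⟨n, t⟩ := z
  simp only at hz
  subst hz
  exact D.pfF_Ωs_zero_section s n

/-- The Moser field vanishes on the zero section. [folklore] -/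
theorem moserField_zero_section (s : ℝ) (n : N) : moserField D.Ωs D.μ s (n, 0) = 0 :=
  moserField_eq_zero _ _ (D.pfF_Ωs_zero_section s n)

/-- The fibre curve of the segment. [folklore] -/
theorem fibreCurve_Ωs (s : ℝ) (n : N) (t : ℝ) :
    fibreCurve (D.Ωs s) n t = fibreCurve D.Ω₀ n t + s • (fibreCurve (D.Ω₀ + D.σ) n t - fibreCurve D.Ω₀ n t) := by
  simp only [fibreCurve_apply, Ωs_apply]
  show D.Ω₀ (n, t) + s • D.σ (n, t) = D.Ω₀ (n, t) + s • ((D.Ω₀ (n, t) + D.σ (n, t)) - D.Ω₀ (n, t))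
  rw [add_sub_cancel_left]

section Smooth

variable [IsManifold (𝓡 3) ∞ N]

/-- `σ` is smooth. [folklore] -/
theorem smooth_σ : IsSmoothForm D.σ := isSmoothForm_mextDeriv (inChart_mextDeriv_holds I34 (N × ℝ) ℝ) D.smooth_μ

/-- `σ` is closed (`d ∘ d = 0`). [folklore] -/
theorem closed_σ : IsClosedForm D.σ := mextDeriv_mextDeriv (inChart_mextDeriv_holds I34 (N × ℝ) ℝ) D.smooth_μ

/-- Each `Ω_s` is smooth. [folklore] -/
theorem smooth_Ωs (s : ℝ) : IsSmoothForm (D.Ωs s) := D.smooth_Ω₀.add (D.smooth_σ.smul s)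

/-- Each `Ω_s` is closed. [folklore] -/
theorem closed_Ωs (s : ℝ) : IsClosedForm (D.Ωs s) := by
  show mextDeriv (D.Ω₀ + s • D.σ) = 0
  rw [mextDeriv_add D.smooth_Ω₀ (D.smooth_σ.smul s), mextDeriv_smul]
  have h0 : mextDeriv D.Ω₀ = 0 := D.closed_Ω₀
  have h1 : mextDeriv D.σ = 0 := D.closed_σ
  rw [h0, h1, smul_zero, add_zero]

/-- **The Pfaffian of the segment has a simple zero along the zero section**, for `s ∈ [0, 1]`.
[cite: CannasGuilleminWoodward2000, proof of Thm. 1] -/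
theorem deriv_pfF_fibreCurve_ne_zero (n : N) {s : ℝ} (hs : s ∈ Icc (0 : ℝ) 1) :
    deriv (fun t => pfF (fibreCurve (D.Ωs s) n t)) 0 ≠ 0 := by
  have h0 : HasDerivAt (fibreCurve D.Ω₀ n) (deriv (fibreCurve D.Ω₀ n) 0) 0 :=
    ((contDiff_fibreCurve D.smooth_Ω₀ n).differentiable (by simp) 0).hasDerivAt
  have h1 : HasDerivAt (fibreCurve (D.Ω₀ + D.σ) n) (deriv (fibreCurve (D.Ω₀ + D.σ) n) 0) 0 :=
    ((contDiff_fibreCurve (D.smooth_Ω₀.add D.smooth_σ) n).differentiable (by simp) 0).hasDerivAt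
  have h01 : fibreCurve (D.Ω₀ + D.σ) n 0 = fibreCurve D.Ω₀ n 0 := by
    show D.Ω₀ (n, 0) + D.σ (n, 0) = D.Ω₀ (n, 0)
    rw [show D.σ (n, 0) = 0 from D.σ_zero n, add_zero]
  have heq : (fun t => pfF (fibreCurve (D.Ωs s) n t)) = fun t =>
      pfF (fibreCurve D.Ω₀ n t + s • (fibreCurve (D.Ω₀ + D.σ) n t - fibreCurve D.Ω₀ n t)) := by
    funext t; rw [fibreCurve_Ωs]
  rw [heq]
  exact deriv_pfF_segment_ne_zero h0 h1 h01 (D.X_ne n) (D.ker_v n) (D.ker_X n) (D.Ω₀_ne n)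
    (D.pos₀ n) (D.pos₁ n) hs

/-! ### The field near the zero section -/

omit [IsManifold (𝓡 3) ∞ N] in
/-- The Moser vector with zero `1`-form datum vanishes. [folklore] -/
theorem _root_.Literature.Geometry.Symplectic.OrigamiMoser.moserVec_zero
    (β : F4 [⋀^Fin 2]→L[ℝ] ℝ) (c : ℝ) : moserVec β 0 c = 0 := by
  simp [moserVec, toE4₁_eq_clm]

/-- **The Moser field is smooth, and the segment non-degenerate off the zero section, near every
point `(s₀, (n₀, 0))` with `s₀ ∈ [0, 1]`.**  In the product chart at `(n₀, 0)`: the representative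
`μ̂` of `μ` factors as `t μ̃` with `μ̃` smooth and `μ̃ = 0` on the zero section (Hadamard's lemma in
the last coordinate and the flatness of `μ`), the Pfaffian of the representative of `Ω_s`
factors as `t π̂` with `π̂` smooth and non-zero near `((s₀, φ n₀), 0)` (simple zero,
`deriv_pfF_fibreCurve_ne_zero`), so that the field read in the chart is the cancelled Moser vector
`moserVec Ω̂_s μ̃ π̂`, a smooth function. [cite: CannasGuilleminWoodward2000, proof of Thm. 1] -/
theorem exists_nhds_zero_section (n₀ : N) {s₀ : ℝ} (hs₀ : s₀ ∈ Icc (0 : ℝ) 1) :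
    ∃ U ∈ 𝓝 ((s₀, ((n₀, (0 : ℝ)) : N × ℝ)) : ℝ × (N × ℝ)),
      (∀ y ∈ U, ContMDiffAt (𝓘(ℝ, ℝ).prod I34) (ModelWithCorners.tangent I34) ∞
        (fun y : ℝ × (N × ℝ) => (⟨y.2, moserField D.Ωs D.μ y.1 y.2⟩ : TangentBundle I34 (N × ℝ))) y) ∧
      (∀ y ∈ U, y.2.2 ≠ 0 → pfF (D.Ωs y.1 y.2) ≠ 0) := by
  set x₀ : N × ℝ := (n₀, 0) with hx₀
  set φ := extChartAt I34 x₀ with hφ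
  set ψ := extChartAt (𝓡 3) n₀ with hψ
  set u₀ : E3 := ψ n₀ with hu₀
  -- the product chart
  have hφ_apply : ∀ z : N × ℝ, φ z = (ψ z.1, z.2) := fun z => by
    rw [hφ, hx₀, extChartAt_prod]; rfl
  have hφ_symm : ∀ q : F4, φ.symm q = (ψ.symm q.1, q.2) := fun q =>
    extChartAt_prod_real_symm_eq x₀ q
  have hφ_target : ∀ {q : F4}, q ∈ φ.target ↔ q.1 ∈ ψ.target := fun {q} =>
    mem_extChartAt_prod_real_target
  have hφ_source : ∀ {z : N × ℝ}, z ∈ φ.source ↔ z.1 ∈ ψ.source := fun {z} =>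
    mem_extChartAt_prod_real_source
  have hu₀t : u₀ ∈ ψ.target := mem_extChartAt_target n₀
  have hTopen : IsOpen ψ.target := isOpen_extChartAt_target n₀
  -- chart representatives
  set A : F4 → F4 [⋀^Fin 2]→L[ℝ] ℝ := D.Ω₀.inChart x₀ with hA
  set S : F4 → F4 [⋀^Fin 2]→L[ℝ] ℝ := D.σ.inChart x₀ with hS
  set M : F4 → F4 [⋀^Fin 1]→L[ℝ] ℝ := D.μ.inChart x₀ with hM
  have hT : φ.target = ψ.target ×ˢ (univ : Set ℝ) := by
    ext q; rw [hφ_target]; simp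
  have hAs : ContDiffOn ℝ ∞ A (ψ.target ×ˢ univ) := hT ▸ D.smooth_Ω₀.contDiffOn_inChart x₀
  have hSs : ContDiffOn ℝ ∞ S (ψ.target ×ˢ univ) := hT ▸ D.smooth_σ.contDiffOn_inChart x₀
  have hMs : ContDiffOn ℝ ∞ M (ψ.target ×ˢ univ) := hT ▸ D.smooth_μ.contDiffOn_inChart x₀
  have hopen2 : IsOpen (ψ.target ×ˢ (univ : Set ℝ)) := hTopen.prod isOpen_univ
  -- the representative of `μ` along a fibre is a fixed linear image of the fibre curve of `μ`
  have hM_fibre : ∀ u ∈ ψ.target, ∃ L : F4 →L[ℝ] F4, ∀ t : ℝ,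
      M (u, t) = ContinuousAlternatingMap.compContinuousLinearMapCLM L (fibreCurve D.μ (ψ.symm u) t) := by
    intro u hu
    refine ⟨(tangentCoordChange (𝓡 3) n₀ (ψ.symm u) (ψ.symm u)).prodMap (ContinuousLinearMap.id ℝ ℝ),
      fun t => ?_⟩
    have hq : ((u, t) : F4) ∈ φ.target := hφ_target.2 hu
    have hz : φ.symm (u, t) ∈ φ.source := φ.map_target hq
    rw [hM, MForm.inChart_eq_of_mem_target _ hq, ContinuousAlternatingMap.compContinuousLinearMapCLM_apply,
      tangentCoordChange_prod_real hz, hφ_symm]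
    rfl
  -- `μ̂` vanishes on the zero section and is flat there
  have hM0 : ∀ u ∈ ψ.target, M (u, 0) = 0 := by
    intro u hu
    obtain ⟨L, hL⟩ := hM_fibre u hu
    rw [hL 0, fibreCurve_apply, D.μ_zero]
    exact map_zero _
  have hMflat : ∀ u ∈ ψ.target, fderiv ℝ M (u, 0) ((0 : E3), (1 : ℝ)) = 0 := by
    intro u hu
    obtain ⟨L, hL⟩ := hM_fibre u hu
    have hcurve : HasDerivAt (fun t : ℝ => M (u, t)) 0 0 := by
      have h := ((ContinuousAlternatingMap.compContinuousLinearMapCLM (ι := Fin 1) (F := ℝ) L).hasFDerivAt).comp_hasDerivAt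
        (0 : ℝ) (D.μ_flat (ψ.symm u))
      rw [map_zero] at h
      refine h.congr_of_eventuallyEq (Eventually.of_forall fun t => ?_)
      exact hL t
    have hMd : HasFDerivAt M (fderiv ℝ M (u, 0)) (u, 0) :=
      (hMs.differentiableOn (by simp) _ ⟨hu, mem_univ _⟩).differentiableAt
        (hopen2.mem_nhds ⟨hu, mem_univ _⟩) |>.hasFDerivAt
    have hc : HasDerivAt (fun t : ℝ => ((u, t) : F4)) ((0 : E3), (1 : ℝ)) 0 := by
      simpa using (hasDerivAt_const (0 : ℝ) u).prodMk (hasDerivAt_id (0 : ℝ))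
    have h2 : HasDerivAt (fun t : ℝ => M (u, t)) (fderiv ℝ M (u, 0) ((0 : E3), (1 : ℝ))) 0 :=
      hMd.comp_hasDerivAt (0 : ℝ) hc
    exact h2.unique hcurve
  -- Hadamard for `μ̂`
  obtain ⟨Mt, hMt_smooth, hMt_eq, hMt_zero'⟩ := exists_local_lastQuot hTopen hMs hM0 hu₀t
  have hMt_zero : ∀ᶠ u in 𝓝 u₀, Mt (u, 0) = 0 := by
    filter_upwards [hMt_zero', hTopen.mem_nhds hu₀t] with u hu hu'
    rw [hu, hMflat u hu']
  -- the Pfaffian of the representative of `Ω_s`, as a function of `((s, u), t)`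
  set P : (ℝ × E3) × ℝ → ℝ := fun x => pfF (A (x.1.2, x.2) + x.1.1 • S (x.1.2, x.2)) with hP
  have hPs : ContDiffOn ℝ ∞ P ((univ ×ˢ ψ.target) ×ˢ univ) := by
    have hq : ContDiffOn ℝ ∞ (fun x : (ℝ × E3) × ℝ => ((x.1.2, x.2) : F4)) ((univ ×ˢ ψ.target) ×ˢ univ) :=
      ((contDiff_snd.comp contDiff_fst).prodMk contDiff_snd).contDiffOn
    have hmaps : MapsTo (fun x : (ℝ × E3) × ℝ => ((x.1.2, x.2) : F4)) ((univ ×ˢ ψ.target) ×ˢ univ)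
        (ψ.target ×ˢ univ) := fun x hx => ⟨hx.1.2, mem_univ _⟩
    have hA' := hAs.comp hq hmaps
    have hS' := hSs.comp hq hmaps
    have hs' : ContDiffOn ℝ ∞ (fun x : (ℝ × E3) × ℝ => x.1.1) ((univ ×ˢ ψ.target) ×ˢ univ) :=
      (contDiff_fst.comp contDiff_fst).contDiffOn
    exact contDiff_pfF.comp_contDiffOn (hA'.add (hs'.smul hS'))
  -- the representative of `Ω_s` is the frame-changed value
  have hrep : ∀ (s : ℝ) {q : F4} (hq : q ∈ φ.target),
      A q + s • S q = (D.Ωs s (φ.symm q)).compContinuousLinearMap (tangentCoordChange I34 x₀ (φ.symm q) (φ.symm q)) := by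
    intro s q hq
    rw [← inChart_Ωs, MForm.inChart_eq_of_mem_target _ hq]
  have hP0 : ∀ x ∈ (univ : Set ℝ) ×ˢ ψ.target, P (x, 0) = 0 := by
    rintro ⟨s, u⟩ ⟨-, hu⟩
    have hq : ((u, (0 : ℝ)) : F4) ∈ φ.target := hφ_target.2 hu
    show pfF (A (u, 0) + s • S (u, 0)) = 0
    rw [hrep s hq]
    refine (pfF_compContinuousLinearMap _ _).trans ?_
    rw [D.pfF_Ωs_zero_section' s _ (by rw [hφ_symm]), mul_zero]
  -- Hadamard for the Pfaffian
  obtain ⟨Pt, hPt_smooth, hPt_eq, hPt_zero⟩ := exists_local_lastQuot (E' := ℝ × E3)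
    (isOpen_univ.prod hTopen) hPs hP0 (u₀ := (s₀, u₀)) ⟨mem_univ _, hu₀t⟩
  -- the simple zero at the centre: `π̂ ((s₀, u₀), 0) ≠ 0`
  have hAc : ∀ t : ℝ, A (u₀, t) = D.Ω₀ (n₀, t) := fun t => (apply_eq_inChart_zero' D.Ω₀ n₀ t).symm
  have hSc : ∀ t : ℝ, S (u₀, t) = D.σ (n₀, t) := fun t => (apply_eq_inChart_zero' D.σ n₀ t).symm
  have hcentre : ∀ t : ℝ, P ((s₀, u₀), t) = pfF (fibreCurve (D.Ωs s₀) n₀ t) := by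
    intro t
    show pfF (A (u₀, t) + s₀ • S (u₀, t)) = _
    rw [hAc t, hSc t]
    rfl
  have hder : fderiv ℝ P ((s₀, u₀), 0) ((0 : ℝ × E3), (1 : ℝ)) ≠ 0 := by
    have hPd : HasFDerivAt P (fderiv ℝ P ((s₀, u₀), 0)) ((s₀, u₀), 0) :=
      (hPs.differentiableOn (by simp) _ ⟨⟨mem_univ _, hu₀t⟩, mem_univ _⟩).differentiableAt
        (((isOpen_univ.prod hTopen).prod isOpen_univ).mem_nhds ⟨⟨mem_univ _, hu₀t⟩, mem_univ _⟩)
        |>.hasFDerivAt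
    have hc : HasDerivAt (fun t : ℝ => (((s₀, u₀), t) : (ℝ × E3) × ℝ)) ((0 : ℝ × E3), (1 : ℝ)) 0 := by
      simpa using (hasDerivAt_const (0 : ℝ) (s₀, u₀)).prodMk (hasDerivAt_id (0 : ℝ))
    have h2 := hPd.comp_hasDerivAt (0 : ℝ) hc
    have heq : (P ∘ fun t : ℝ => (((s₀, u₀), t) : (ℝ × E3) × ℝ)) =
        fun t => pfF (fibreCurve (D.Ωs s₀) n₀ t) := by
      funext t; exact hcentre t
    rw [heq] at h2
    rw [← h2.deriv]
    exact D.deriv_pfF_fibreCurve_ne_zero n₀ hs₀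
  have hPt_ne : Pt ((s₀, u₀), 0) ≠ 0 := by
    rw [hPt_zero.self_of_nhds]; exact hder
  have hPt_ev : ∀ᶠ w in 𝓝 ((((s₀, u₀) : ℝ × E3), (0 : ℝ)) : (ℝ × E3) × ℝ), Pt w ≠ 0 :=
    hPt_smooth.continuous.continuousAt.eventually_ne hPt_ne
  -- open neighbourhoods carrying the three factorisations
  obtain ⟨B₁, hB₁, hB₁o, hB₁m⟩ := _root_.eventually_nhds_iff.1 (hMt_eq.and hMt_zero)
  obtain ⟨B₂, hB₂, hB₂o, hB₂m⟩ := _root_.eventually_nhds_iff.1 hPt_eq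
  obtain ⟨B₃, hB₃, hB₃o, hB₃m⟩ := _root_.eventually_nhds_iff.1 hPt_ev
  set O : Set ((ℝ × E3) × ℝ) := (Prod.snd ∘ Prod.fst) ⁻¹' B₁ ∩ Prod.fst ⁻¹' B₂ ∩ B₃ with hO
  have hOo : IsOpen O :=
    ((hB₁o.preimage (continuous_snd.comp continuous_fst)).inter (hB₂o.preimage continuous_fst)).inter hB₃o
  set f : ℝ × (N × ℝ) → (ℝ × E3) × ℝ := fun y => ((y.1, ψ y.2.1), y.2.2) with hf
  have hfc : ContinuousOn f ((univ : Set ℝ) ×ˢ φ.source) := by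
    have hψc : ContinuousOn (fun y : ℝ × (N × ℝ) => ψ y.2.1) ((univ : Set ℝ) ×ˢ φ.source) := by
      refine (continuousOn_extChartAt n₀).comp (continuous_fst.comp continuous_snd).continuousOn ?_
      intro y hy
      exact hφ_source.1 hy.2
    exact (continuous_fst.continuousOn.prodMk hψc).prodMk (continuous_snd.comp continuous_snd).continuousOn
  set U : Set (ℝ × (N × ℝ)) := ((univ : Set ℝ) ×ˢ φ.source) ∩ f ⁻¹' O with hU
  have hUo : IsOpen U := hfc.isOpen_inter_preimage (isOpen_univ.prod (isOpen_extChartAt_source x₀)) hOo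
  have hx₀U : ((s₀, x₀) : ℝ × (N × ℝ)) ∈ U := by
    refine ⟨⟨mem_univ _, mem_extChartAt_source x₀⟩, ?_⟩
    show ((s₀, ψ n₀), (0 : ℝ)) ∈ O
    exact ⟨⟨hB₁m, hB₂m⟩, hB₃m⟩
  -- the field read in the chart on `U` is the cancelled Moser vector
  set V : ℝ × F4 → F4 := fun x =>
    moserVec (A x.2 + x.1 • S x.2) (Mt x.2) (Pt ((x.1, x.2.1), x.2.2)) with hV
  have key : ∀ y ∈ U,
      tangentCoordChange I34 y.2 x₀ y.2 (moserField D.Ωs D.μ y.1 y.2) = V (y.1, φ y.2) := by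
    rintro ⟨s, z⟩ ⟨⟨-, hz⟩, ⟨hB₁z, hB₂z⟩, hB₃z⟩
    rw [tangentCoordChange_moserField _ _ x₀ s hz, inChart_Ωs]
    show plainMoser (A (φ z) + s • S (φ z)) (M (φ z)) =
      moserVec (A (φ z) + s • S (φ z)) (Mt (φ z)) (Pt ((s, (φ z).1), (φ z).2))
    have hB₁z' : ψ z.1 ∈ B₁ := hB₁z
    have hB₂z' : (s, ψ z.1) ∈ B₂ := hB₂z
    obtain ⟨hMz, hMz0⟩ := hB₁ _ hB₁z'
    have hPz : pfF (A (ψ z.1, z.2) + s • S (ψ z.1, z.2)) = z.2 * Pt ((s, ψ z.1), z.2) := hB₂ _ hB₂z' z.2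
    rw [hφ_apply]
    by_cases ht : z.2 = 0
    · have hPz0 : pfF (A (ψ z.1, z.2) + s • S (ψ z.1, z.2)) = 0 := by rw [hPz, ht, zero_mul]
      have hMz0' : Mt (ψ z.1, z.2) = 0 := by rw [ht]; exact hMz0
      rw [plainMoser_eq_zero hPz0, hMz0', moserVec_zero]
    · exact plainMoser_eq_moserVec ht hPz (hMz z.2)
  refine ⟨U, hUo.mem_nhds hx₀U, fun y hy => ?_, fun y hy ht => ?_⟩
  · -- smoothness at `y`
    obtain ⟨⟨-, hz⟩, ⟨hB₁z, hB₂z⟩, hB₃z⟩ := hy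
    have hB₃z' : ((y.1, ψ y.2.1), y.2.2) ∈ B₃ := hB₃z
    have hq1 : (φ y.2).1 ∈ ψ.target := hφ_target.1 (φ.map_source hz)
    have hVs : ContDiffAt ℝ ∞ V (y.1, φ y.2) := by
      have hmem : φ y.2 ∈ ψ.target ×ˢ (univ : Set ℝ) := ⟨hq1, mem_univ _⟩
      have hA2 : ContDiffAt ℝ ∞ (fun x : ℝ × F4 => A x.2) (y.1, φ y.2) :=
        (hAs.contDiffAt (hopen2.mem_nhds hmem)).comp (y.1, φ y.2) contDiffAt_snd
      have hS2 : ContDiffAt ℝ ∞ (fun x : ℝ × F4 => S x.2) (y.1, φ y.2) :=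
        (hSs.contDiffAt (hopen2.mem_nhds hmem)).comp (y.1, φ y.2) contDiffAt_snd
      have hMt2 : ContDiffAt ℝ ∞ (fun x : ℝ × F4 => Mt x.2) (y.1, φ y.2) :=
        hMt_smooth.contDiffAt.comp (y.1, φ y.2) contDiffAt_snd
      have hPt2 : ContDiffAt ℝ ∞ (fun x : ℝ × F4 => Pt ((x.1, x.2.1), x.2.2)) (y.1, φ y.2) :=
        hPt_smooth.contDiffAt.comp (y.1, φ y.2)
          ((contDiffAt_fst.prodMk (contDiffAt_fst.comp (y.1, φ y.2) contDiffAt_snd)).prodMk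
            (contDiffAt_snd.comp (y.1, φ y.2) contDiffAt_snd))
      have hin : ContDiffAt ℝ ∞ (fun x : ℝ × F4 =>
          ((A x.2 + x.1 • S x.2, Mt x.2, Pt ((x.1, x.2.1), x.2.2)) :
            (F4 [⋀^Fin 2]→L[ℝ] ℝ) × (F4 [⋀^Fin 1]→L[ℝ] ℝ) × ℝ)) (y.1, φ y.2) :=
        (hA2.add (contDiffAt_fst.smul hS2)).prodMk (hMt2.prodMk hPt2)
      have hne : Pt ((y.1, (φ y.2).1), (φ y.2).2) ≠ 0 := by
        rw [hφ_apply]; exact hB₃ _ hB₃z'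
      have hout : ContDiffAt ℝ ∞
          (fun x : (F4 [⋀^Fin 2]→L[ℝ] ℝ) × (F4 [⋀^Fin 1]→L[ℝ] ℝ) × ℝ => moserVec x.1 x.2.1 x.2.2)
          (A (φ y.2) + y.1 • S (φ y.2), Mt (φ y.2), Pt ((y.1, (φ y.2).1), (φ y.2).2)) :=
        contDiffOn_moserVec.contDiffAt
          ((isOpen_ne_fun (continuous_snd.comp continuous_snd) continuous_const).mem_nhds hne)
      exact ContDiffAt.comp
        (g := fun x : (F4 [⋀^Fin 2]→L[ℝ] ℝ) × (F4 [⋀^Fin 1]→L[ℝ] ℝ) × ℝ => moserVec x.1 x.2.1 x.2.2)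
        (f := fun x : ℝ × F4 => ((A x.2 + x.1 • S x.2, Mt x.2, Pt ((x.1, x.2.1), x.2.2)) :
            (F4 [⋀^Fin 2]→L[ℝ] ℝ) × (F4 [⋀^Fin 1]→L[ℝ] ℝ) × ℝ))
        (y.1, φ y.2) hout hin
    refine contMDiffAt_moserField D.Ωs D.μ x₀ hz hVs ?_
    filter_upwards [hUo.mem_nhds ⟨⟨mem_univ _, hz⟩, ⟨hB₁z, hB₂z⟩, hB₃z⟩] with y' hy'
    exact key y' hy'
  · -- non-degeneracy off the zero section
    obtain ⟨⟨-, hz⟩, ⟨-, hB₂z⟩, hB₃z⟩ := hy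
    have hB₂z' : (y.1, ψ y.2.1) ∈ B₂ := hB₂z
    have hB₃z' : ((y.1, ψ y.2.1), y.2.2) ∈ B₃ := hB₃z
    have hq : φ y.2 ∈ φ.target := φ.map_source hz
    have hPz : pfF (A (ψ y.2.1, y.2.2) + y.1 • S (ψ y.2.1, y.2.2)) =
        y.2.2 * Pt ((y.1, ψ y.2.1), y.2.2) := hB₂ _ hB₂z' y.2.2
    have hne : pfF (A (ψ y.2.1, y.2.2) + y.1 • S (ψ y.2.1, y.2.2)) ≠ 0 := by
      rw [hPz]; exact mul_ne_zero ht (hB₃ _ hB₃z')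
    intro h0
    apply hne
    rw [← hφ_apply, hrep y.1 hq]
    refine (pfF_compContinuousLinearMap _ _).trans ?_
    have hzz : φ.symm (φ y.2) = y.2 := φ.left_inv hz
    rw [show pfF (D.Ωs y.1 (φ.symm (φ y.2))) = 0 from by rw [hzz]; exact h0, mul_zero]

end Smooth

end MoserData

end OrigamiMoser

end Literature.Geometry.Symplectic

end
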